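import Summits.QuantumFields.YangMills.Theorems.LuscherReductionOneSiteLevelsValleyShells

/-!
# VALLEY, step 5b: the refined upper-shell bound
# (support module for `stub_absUpperValleyMag` of crux `OneSiteLevels`, route `LuscherReduction`, item stmt-QuantumFields-20007;
# fleet lead prover ym-luscher-20007-p1 g2)

`shell2_J_le'`: as `…ValleyShells.shell2_J_le`, but the NEAR case is split into the inner region `(9/4)ρ² + 9δ' ≤ 1` (where the
completion-of-the-square factor is `≤ 1` and the gain is `(5/16)·min((1−36δ')t²/2, 1/500)`) and the outer region (factor `≤ e^{(27/4+9δ')/10⁵}`,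
gain saturated at `(5/16)/500`).  This is the form whose `B → ∞` limit closes (the unrefined bound pays the constant factor against a
decaying gain).

## WHAT THIS IS NOT
Not the assembled valley estimate; NOT the crux, NOT THE CLAY GAP.  Sorry-free; no new definition, no named fact.
-/

set_option autoImplicit false

noncomputable section

open MeasureTheory Filter Topology Real
open scoped Matrix Quaternion RealInnerProductSpace BigOperators
open Literature.MathematicalPhysics.QuantumFieldTheory
open Literature.MathematicalPhysics.QuantumLattice
open Literature.Analysis.OperatorTheory.YMMatrixModel

namespace Summit.QuantumFields.YangMills.Theorems.FemtoTransferGap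

variable {B : ℝ}

/-- **Shell-2 supersolution bound, refined** (FAR ∪ NEAR-inner ∪ NEAR-outer): the completion-of-the-square loss `e^{(27/4+9δ')/10⁵}` is only
paid where `(9/4)ρ² + 9δ' > 1`, and there the Hessian gain is saturated (`min = 1/500`). [cite: SimonB1983DiscreteSpectrum, §2] [cite: Luscher1983, §2] -/
theorem shell2_J_le' (hB : 54 ≤ B) {t : ℝ} (ht0 : 0 < t) {δ' : ℝ} (hδ'0 : 0 < δ') (hδ' : δ' ≤ 1 / 72)
    (hεB : 9 / 4 * δ' + 1 / 2 * (2 * Real.sqrt 2 * √(1 / (100000 * B)) + 9 * δ' * (2 + 36 * δ')) ≤ 1 / 18)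
    (U : Cfg) (hρt : t ≤ ‖zmCoord 1 U‖) :
    Real.exp ((0 - 1 / 2) * B * wilsonAction su2Rep U) *
        ∫ V, linkE B U V * Real.exp (-(1 / 2 + 0) * B * wilsonAction su2Rep V) ∂(configMeasure SU2 1)
      ≤ linkCE B / (1 - 27 / B) * max (Real.exp (-(1 / 200000))) (max
          ((1 + 18 * (9 / 4 * δ' + 1 / 2 * (2 * Real.sqrt 2 * √(1 / (100000 * B)) + 9 * δ' * (2 + 36 * δ'))))
            * (1 - 5 / 16 * min (1 / 2 * (1 - 36 * δ') * t ^ 2) (1 / 500)) + 512 * Real.exp (-(B * δ' / 4)))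
          ((1 + 18 * (9 / 4 * δ' + 1 / 2 * (2 * Real.sqrt 2 * √(1 / (100000 * B)) + 9 * δ' * (2 + 36 * δ'))))
            * Real.exp ((27 / 4 + 9 * δ') / 100000) * (1 - 5 / 16 * (1 / 500)) + 512 * Real.exp (-(B * δ' / 4)))) := by
  have hB0 : 0 < B := by linarith
  have hρ0 : 0 < ‖zmCoord 1 U‖ := lt_of_lt_of_le ht0 hρt
  have hS0 : 0 ≤ wilsonAction su2Rep U := wilsonAction_su2_nonneg U
  have hρ3 := norm_zmCoord_sq_le_three U
  have h27 : 0 < 1 - 27 / B := by rw [sub_pos, div_lt_one hB0]; linarith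
  have h27'' : (0:ℝ) ≤ 27 / B := by positivity
  have h27' : 1 - 27 / B ≤ 1 := by linarith only [h27'']
  have h𝒢 : Real.exp (6 * B) * Real.sqrt (π / B) ^ 9 / (2 * π ^ 2) ^ 3 ≤ linkCE B / (1 - 27 / B) := by
    rw [le_div_iff₀ h27, mul_comm]; exact gauss_le_linkCE hB0
  have hL0 : 0 ≤ linkCE B / (1 - 27 / B) := div_nonneg (linkCE_pos hB0.le).le h27.le
  have hLL : linkCE B ≤ linkCE B / (1 - 27 / B) := by
    rw [le_div_iff₀ h27]; nlinarith [linkCE_pos hB0.le]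
  by_cases hfar : 1 / 100000 ≤ B * wilsonAction su2Rep U
  · -- FAR
    refine (valleyJ_zero_le hB0 U).trans ?_
    have he : Real.exp (-(B / 2) * wilsonAction su2Rep U) ≤ Real.exp (-(1 / 200000)) := Real.exp_le_exp.2 (by linarith)
    calc Real.exp (-(B / 2) * wilsonAction su2Rep U) * linkCE B ≤ Real.exp (-(1 / 200000)) * (linkCE B / (1 - 27 / B)) :=
          mul_le_mul he hLL (linkCE_pos hB0.le).le (Real.exp_pos _).le
      _ = linkCE B / (1 - 27 / B) * Real.exp (-(1 / 200000)) := by ring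
      _ ≤ _ := mul_le_mul_of_nonneg_left (le_max_left _ _) hL0
  · -- NEAR
    push Not at hfar
    have hSB : √(wilsonAction su2Rep U) ≤ √(1 / (100000 * B)) :=
      Real.sqrt_le_sqrt (by rw [le_div_iff₀ (by positivity)]; linarith)
    set ε₂ : ℝ := 9 / 4 * δ' + 1 / 2 * (2 * Real.sqrt 2 * √(1 / (100000 * B)) + 9 * δ' * (2 + 36 * δ')) with hε₂
    have hεU : 9 / 4 * δ' + (1 / 2 + 0) * (2 * Real.sqrt 2 * √(wilsonAction su2Rep U) + 9 * δ' * (2 + 36 * δ')) ≤ ε₂ := by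
      rw [hε₂]
      have := mul_le_mul_of_nonneg_left hSB (by positivity : (0:ℝ) ≤ 2 * Real.sqrt 2)
      linarith
    have hε0 : 0 ≤ 9 / 4 * δ' + (1 / 2 + 0) * (2 * Real.sqrt 2 * √(wilsonAction su2Rep U) + 9 * δ' * (2 + 36 * δ')) := by positivity
    have hgs : 64 * (1 / 2 + 0) ^ 2 * ‖zmCoord 1 U‖ ^ 2 * (B * wilsonAction su2Rep U) ≤ 100 := by
      have h1 : ‖zmCoord 1 U‖ ^ 2 * (B * wilsonAction su2Rep U) ≤ 3 * (1 / 100000) :=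
        mul_le_mul hρ3 hfar.le (by positivity) (by norm_num)
      nlinarith only [h1]
    have hexp : Real.exp (B * wilsonAction su2Rep U * (9 * (1 / 2 + 0) ^ 2 * ‖zmCoord 1 U‖ ^ 2 + 18 * δ' * (1 / 2 + 0) - 1))
        ≤ Real.exp ((27 / 4 + 9 * δ') / 100000) := by
      refine Real.exp_le_exp.2 ?_
      have h1 : 9 * (1 / 2 + 0) ^ 2 * ‖zmCoord 1 U‖ ^ 2 + 18 * δ' * (1 / 2 + 0) - 1 ≤ 27 / 4 + 9 * δ' := by nlinarith only [hρ3]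
      have h2 : 0 ≤ 27 / 4 + 9 * δ' := by positivity
      have h3 : 0 ≤ B * wilsonAction su2Rep U := by positivity
      calc B * wilsonAction su2Rep U * (9 * (1 / 2 + 0) ^ 2 * ‖zmCoord 1 U‖ ^ 2 + 18 * δ' * (1 / 2 + 0) - 1)
          ≤ B * wilsonAction su2Rep U * (27 / 4 + 9 * δ') := mul_le_mul_of_nonneg_left h1 h3
        _ ≤ 1 / 100000 * (27 / 4 + 9 * δ') := mul_le_mul_of_nonneg_right hfar.le h2
        _ = (27 / 4 + 9 * δ') / 100000 := by ring
    have hmin : min (1 / 2 * (1 - 36 * δ') * t ^ 2) (1 / 500) ≤ min ((1 / 2 + 0) * (1 - 36 * δ') * ‖zmCoord 1 U‖ ^ 2) (1 / 500) := by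
      refine min_le_min ?_ le_rfl
      have h2 : t ^ 2 ≤ ‖zmCoord 1 U‖ ^ 2 := pow_le_pow_left₀ ht0.le hρt 2
      have h3' : 0 ≤ 1 - 36 * δ' := by linarith only [hδ']
      have h3 : 0 ≤ 1 / 2 * (1 - 36 * δ') := by positivity
      rw [show (1 / 2 + (0:ℝ)) = 1 / 2 by ring]
      exact mul_le_mul_of_nonneg_left h2 h3
    have hm500 : min ((1 / 2 + 0) * (1 - 36 * δ') * ‖zmCoord 1 U‖ ^ 2) (1 / 500) ≤ 1 / 500 := min_le_right _ _
    have hF : ∀ W : Cfg, Real.exp ((0 - 1 / 2) * B * wilsonAction su2Rep U) *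
        (linkE B U (U * W) * Real.exp (-(1 / 2 + 0) * B * wilsonAction su2Rep (U * W)))
        ≤ Real.exp (6 * B - B / 2 * ∑ e : Edge 3 1, (2 - 2 * scalarPart (W e))) := by
      intro W
      rw [linkE_mul_eq, ← Real.exp_add, ← Real.exp_add]
      refine Real.exp_le_exp.2 ?_
      have h3 : 0 ≤ B * wilsonAction su2Rep (U * W) := mul_nonneg hB0.le (wilsonAction_su2_nonneg (U * W))
      have h4 : 0 ≤ B * ∑ e : Edge 3 1, (2 - 2 * scalarPart (W e)) := mul_nonneg hB0.le (sumDefect_nonneg W)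
      have h5 : 0 ≤ B * wilsonAction su2Rep U := mul_nonneg hB0.le hS0
      linarith only [h3, h4, h5]
    -- the two NEAR sub-cases, as a bound on the U-dependent bracket
    set A : ℝ := (1 + 18 * ε₂) * (1 - 5 / 16 * min (1 / 2 * (1 - 36 * δ') * t ^ 2) (1 / 500)) + 512 * Real.exp (-(B * δ' / 4)) with hAdef
    set A' : ℝ := (1 + 18 * ε₂) * Real.exp ((27 / 4 + 9 * δ') / 100000) * (1 - 5 / 16 * (1 / 500)) + 512 * Real.exp (-(B * δ' / 4))
      with hA'def
    have hε₂0 : 0 ≤ ε₂ := le_trans hε0 hεU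
    have hbr : (1 + 18 * (9 / 4 * δ' + (1 / 2 + 0) * (2 * Real.sqrt 2 * √(wilsonAction su2Rep U) + 9 * δ' * (2 + 36 * δ'))))
          * Real.exp (B * wilsonAction su2Rep U * (9 * (1 / 2 + 0) ^ 2 * ‖zmCoord 1 U‖ ^ 2 + 18 * δ' * (1 / 2 + 0) - 1))
          * (1 - 5 / 16 * min ((1 / 2 + 0) * (1 - 36 * δ') * ‖zmCoord 1 U‖ ^ 2) (1 / 500)) + 512 * Real.exp (-(B * δ' / 4))
        ≤ max A A' := by
      have hg0 : 0 ≤ 1 - 5 / 16 * min ((1 / 2 + 0) * (1 - 36 * δ') * ‖zmCoord 1 U‖ ^ 2) (1 / 500) := by linarith only [hm500]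
      by_cases hin : 9 / 4 * ‖zmCoord 1 U‖ ^ 2 + 9 * δ' ≤ 1
      · -- inner: no completion-of-the-square loss
        have hexp1 : Real.exp (B * wilsonAction su2Rep U * (9 * (1 / 2 + 0) ^ 2 * ‖zmCoord 1 U‖ ^ 2 + 18 * δ' * (1 / 2 + 0) - 1)) ≤ 1 := by
          rw [Real.exp_le_one_iff]
          have h1 : 9 * (1 / 2 + 0) ^ 2 * ‖zmCoord 1 U‖ ^ 2 + 18 * δ' * (1 / 2 + 0) - 1 ≤ 0 := by linarith only [hin]
          exact mul_nonpos_of_nonneg_of_nonpos (by positivity) h1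
        refine le_trans ?_ (le_max_left _ _)
        rw [hAdef]
        refine add_le_add_left ?_ _
        calc _ ≤ (1 + 18 * ε₂) * 1 * (1 - 5 / 16 * min ((1 / 2 + 0) * (1 - 36 * δ') * ‖zmCoord 1 U‖ ^ 2) (1 / 500)) :=
              mul_le_mul_of_nonneg_right (mul_le_mul (by linarith only [hεU]) hexp1 (Real.exp_pos _).le (by positivity)) hg0
          _ ≤ _ := by rw [mul_one]; exact mul_le_mul_of_nonneg_left (by linarith only [hmin]) (by positivity)
      · -- outer: the gain is saturated
        push Not at hin
        have hsat : min ((1 / 2 + 0) * (1 - 36 * δ') * ‖zmCoord 1 U‖ ^ 2) (1 / 500) = 1 / 500 := by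
          refine min_eq_right ?_
          nlinarith only [hin, hδ']
        refine le_trans ?_ (le_max_right _ _)
        rw [hA'def, hsat]
        refine add_le_add_left ?_ _
        exact mul_le_mul_of_nonneg_right (mul_le_mul (by linarith only [hεU]) hexp (Real.exp_pos _).le (by positivity))
          (by norm_num)
    have hmax0 : 0 ≤ max A A' := le_trans (by rw [hA'def]; positivity) (le_max_right _ _)
    have h := valleyJ_le_of_near hB0 (by norm_num) U hρ0 hδ'0 hδ' hF (hεU.trans hεB) hgs
    refine h.trans ?_
    calc (Real.exp (6 * B) * Real.sqrt (π / B) ^ 9 / (2 * π ^ 2) ^ 3) *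
          ((1 + 18 * (9 / 4 * δ' + (1 / 2 + 0) * (2 * Real.sqrt 2 * √(wilsonAction su2Rep U) + 9 * δ' * (2 + 36 * δ'))))
            * Real.exp (B * wilsonAction su2Rep U * (9 * (1 / 2 + 0) ^ 2 * ‖zmCoord 1 U‖ ^ 2 + 18 * δ' * (1 / 2 + 0) - 1))
            * (1 - 5 / 16 * min ((1 / 2 + 0) * (1 - 36 * δ') * ‖zmCoord 1 U‖ ^ 2) (1 / 500)) + 512 * Real.exp (-(B * δ' / 4)))
        ≤ (linkCE B / (1 - 27 / B)) * max A A' :=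
          mul_le_mul h𝒢 hbr
            (add_nonneg (mul_nonneg (mul_nonneg (by linarith only [hε0]) (Real.exp_pos _).le) (by linarith only [hm500]))
              (by positivity)) hL0
      _ ≤ _ := mul_le_mul_of_nonneg_left (le_max_right _ _) hL0

end Summit.QuantumFields.YangMills.Theorems.FemtoTransferGap

end
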